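import Summits.QuantumFields.YangMills.Theorems.FlatTubeReductionOneSiteQuasimode
import Summits.QuantumFields.YangMills.Theorems.LuscherReductionTwistedTraceScalingBOAssemblyPrelim
import Summits.QuantumFields.YangMills.Theorems.LuscherReductionOneSiteLevelsValleyShells
import HarnessLib

/-!
# The DRESSED near-top one-site amplitude `φ₀ = φ/W` from the concentrated rate-grade quasimode — the brick field `BORateBricks.hTop` modulo the weight's behaviour at the vacuum
# (route `FlatTubeReduction`, crux K1 `NearFlatRatioLaw` stmt-QuantumFields-24720; seat `ym-line-ftr-p1` g9; R2b1 RECORD rung — no summit statement is proved here)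

The FLOOR-WITH-RATE clause of the rate-grade Born–Oppenheimer package (`floor_rate_clause_of_bricks`, p651403; brick field `BORateBricks.hTop`, p651470) needs a one-site amplitude `φ₀`,
supported in the slow window, with `⟨φ₀W, K_Bφ₀W⟩ ≥ e^{−C''λ_b²}·μ₀(B)·‖φ₀‖²` for the DRESSED weight `W` (`W² = λ(u)/λ(1) = e^{−V(u)} ≤ 1`).  With `φ₀ := φ/W` one has `φ₀W = φ`, so
the rate-grade quasimode `φ` of `Quasimode.exists_concentrated_quasimode_levelValue` (p647846) does it PROVIDED the norm loss `‖φ/W‖² ≤ (1 + κ_W·Cλ_b²)‖φ‖²` is second order — which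
is exactly what its second-moment CONCENTRATION `∫‖zm‖²φ² ≤ Cλ_b²‖φ‖²` buys, given the pointwise vacuum behaviour `1 ≤ W(u)²(1 + κ_W‖zmCoord 1 u‖²)` of the weight on the support
(all-upper, `orbitDist < √λ_b`).  THIS FILE proves that transport (`Lines/borate-floor-g9.md`):
* ★★ `dressed_near_top` — for every `κ_W ≥ 0` there are `C'' ≥ 0`, `B₀` such that for `B ≥ B₀`, every measurable gauge-invariant weight `W` with `0 < W ≤ 1` and
  `1 ≤ W²(1 + κ_W‖zm‖²)` on `{all-upper} ∩ {orbitDist < √λ_b(B)}`, and every window `𝒰` containing that set, admit `φ₀` (bounded measurable, gauge invariant, `supp ⊆ 𝒰`, `‖φ₀‖² > 0`)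
  with `e^{−C''λ_b(B)²}·μ₀(B)·‖φ₀‖² ≤ ⟨φ₀W, K_Bφ₀W⟩` — the field `hTop` at `B = L³β`.
HONEST FRAMING: one-site bookkeeping over p647846; the weight `W` itself (adapted fibres) is OPEN with the pooled rate twin; not a gap, not Clay.  No defs, no `sorry`.
-/

set_option autoImplicit false

noncomputable section

open MeasureTheory Filter Topology Real
open scoped BigOperators
open Literature.MathematicalPhysics.QuantumFieldTheory
open Literature.MathematicalPhysics.QuantumLattice

namespace Summit.QuantumFields.YangMills.Theorems.FemtoTransferGap.RateTube

open Summit.QuantumFields.YangMills.Theorems.FemtoTransferGap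
open Summit.QuantumFields.YangMills.Theorems.FemtoTransferGap.TwoLattice.ConstTube

/-- ★★ **THE DRESSED NEAR-TOP AMPLITUDE** `φ₀ = φ/W`: see the module docstring. [cite: Luscher1983, §3] [cite: Simon1983, Thm. 1.1] -/
theorem dressed_near_top {κW : ℝ} (hκW : 0 ≤ κW) :
    ∃ C'' B₀ : ℝ, 0 ≤ C'' ∧ ∀ B : ℝ, B₀ ≤ B →
      ∀ W : GaugeConfig 3 1 SU2 → ℝ, Measurable W →
        (∀ (g : Site 3 1 → SU2) (u : GaugeConfig 3 1 SU2), W (gaugeTransform g u) = W u) →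
        (∀ u : GaugeConfig 3 1 SU2, (∀ e : Edge 3 1, 0 < scalarPart (u e)) → orbitDist u < Real.sqrt (bareLambda B) →
          0 < W u ∧ W u ≤ 1 ∧ 1 ≤ W u ^ 2 * (1 + κW * ‖zmCoord 1 u‖ ^ 2)) →
        ∀ 𝒰 : Set (GaugeConfig 3 1 SU2), (∀ u : GaugeConfig 3 1 SU2, (∀ e : Edge 3 1, 0 < scalarPart (u e)) → orbitDist u < Real.sqrt (bareLambda B) → u ∈ 𝒰) →
          ∃ φ₀ : GaugeConfig 3 1 SU2 → ℝ, Measurable φ₀ ∧ (∃ C : ℝ, ∀ u, |φ₀ u| ≤ C) ∧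
            (∀ (g : Site 3 1 → SU2) (u : GaugeConfig 3 1 SU2), φ₀ (gaugeTransform g u) = φ₀ u) ∧ (∀ u, φ₀ u ≠ 0 → u ∈ 𝒰) ∧ 0 < l2 φ₀ φ₀ ∧
            Real.exp (-(C'' * bareLambda B ^ 2)) * levelValue su2Rep 1 B 0 * l2 φ₀ φ₀ ≤ qform su2Rep B (fun u => φ₀ u * W u) (fun u => φ₀ u * W u) := by
  obtain ⟨C, B₀, hC0, hQ⟩ := Quasimode.exists_concentrated_quasimode_levelValue
  refine ⟨C + κW * C, max B₀ 1, by positivity, fun B hB W hWm hWg hWvac 𝒰 h𝒰 => ?_⟩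
  have hB1 : 1 ≤ B := (le_max_right _ _).trans hB
  have hB0 : 0 < B := by linarith
  obtain ⟨φ, hm, ⟨C', hC'⟩, hg, hs, hpos, hq, hmom⟩ := hQ B ((le_max_left _ _).trans hB)
  have hC'0 : 0 ≤ C' := (abs_nonneg _).trans (hC' 1)
  -- the weight on the support of `φ`
  have hWs : ∀ u, φ u ≠ 0 → 0 < W u ∧ W u ≤ 1 ∧ 1 ≤ W u ^ 2 * (1 + κW * ‖zmCoord 1 u‖ ^ 2) := fun u hu => hWvac u (hs u hu).1 (hs u hu).2
  set φ₀ : GaugeConfig 3 1 SU2 → ℝ := fun u => φ u / W u with hφ₀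
  -- `φ₀ W = φ`
  have hprod : (fun u => φ₀ u * W u) = φ := by
    funext u
    by_cases hu : φ u = 0
    · simp [hφ₀, hu]
    · rw [hφ₀]; dsimp only; exact div_mul_cancel₀ _ (hWs u hu).1.ne'
  -- pointwise bounds
  have hpt : ∀ u, φ₀ u ^ 2 ≤ φ u ^ 2 * (1 + κW * ‖zmCoord 1 u‖ ^ 2) := fun u => by
    by_cases hu : φ u = 0
    · simp [hφ₀, hu]
    · obtain ⟨hW0, -, hW⟩ := hWs u hu
      rw [hφ₀]; dsimp only
      rw [div_pow, div_le_iff₀ (by positivity)]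
      nlinarith [sq_nonneg (φ u), hW]
  have hpt' : ∀ u, φ u ^ 2 ≤ φ₀ u ^ 2 := fun u => by
    by_cases hu : φ u = 0
    · simp [hφ₀, hu]
    · obtain ⟨hW0, hW1, -⟩ := hWs u hu
      rw [hφ₀]; dsimp only
      rw [div_pow, le_div_iff₀ (by positivity)]
      have : W u ^ 2 ≤ 1 := by nlinarith
      nlinarith [sq_nonneg (φ u)]
  have hbd : ∀ u, |φ₀ u| ≤ C' * (1 + 3 * κW) := fun u => by
    by_cases hu : φ u = 0
    · have : φ₀ u = 0 := by simp [hφ₀, hu]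
      rw [this, abs_zero]; positivity
    · obtain ⟨hW0, hW1, hW⟩ := hWs u hu
      have hz := norm_zmCoord_sq_le_three u
      have hinv : 1 / W u ≤ 1 + 3 * κW := by
        rw [div_le_iff₀ hW0]
        have h1 : 1 ≤ W u ^ 2 * (1 + 3 * κW) := hW.trans (by
          apply mul_le_mul_of_nonneg_left _ (sq_nonneg _); nlinarith)
        nlinarith
      rw [hφ₀]; dsimp only
      rw [abs_div, abs_of_pos hW0, div_eq_mul_one_div]
      exact mul_le_mul (hC' u) hinv (by positivity) hC'0
  -- integrability
  have hi0 : Integrable (fun u => φ₀ u ^ 2) (configMeasure SU2 1) :=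
    integrable_of_measurable_abs_le _ ((hm.div hWm).pow_const 2) (C := (C' * (1 + 3 * κW)) ^ 2) fun u => by
      rw [abs_pow]; exact pow_le_pow_left₀ (abs_nonneg _) (hbd u) 2
  have hiφ : Integrable (fun u => φ u ^ 2) (configMeasure SU2 1) :=
    integrable_of_measurable_abs_le _ (hm.pow_const 2) (C := C' ^ 2) fun u => by rw [abs_pow]; exact pow_le_pow_left₀ (abs_nonneg _) (hC' u) 2
  have him : Integrable (fun u => ‖zmCoord 1 u‖ ^ 2 * φ u ^ 2) (configMeasure SU2 1) :=
    integrable_of_measurable_abs_le _ (((continuous_zmCoord 1).norm.measurable.pow_const 2).mul (hm.pow_const 2)) (C := 3 * C' ^ 2)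
      fun u => by
        rw [abs_mul, abs_pow, abs_pow, abs_norm]
        exact mul_le_mul (norm_zmCoord_sq_le_three u) (pow_le_pow_left₀ (abs_nonneg _) (hC' u) 2) (by positivity) (by norm_num)
  -- norms
  have hl2φ : l2 φ φ = ∫ u, φ u ^ 2 ∂configMeasure SU2 1 := l2_self_eq_integral_sq φ
  have hl2φ₀ : l2 φ₀ φ₀ = ∫ u, φ₀ u ^ 2 ∂configMeasure SU2 1 := l2_self_eq_integral_sq φ₀
  have hlow : l2 φ φ ≤ l2 φ₀ φ₀ := by rw [hl2φ, hl2φ₀]; exact integral_mono hiφ hi0 hpt'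
  have hup : l2 φ₀ φ₀ ≤ (1 + κW * (C * bareLambda B ^ 2)) * l2 φ φ := by
    rw [hl2φ₀]
    calc ∫ u, φ₀ u ^ 2 ∂configMeasure SU2 1 ≤ ∫ u, (φ u ^ 2 + κW * (‖zmCoord 1 u‖ ^ 2 * φ u ^ 2)) ∂configMeasure SU2 1 := by
          refine integral_mono hi0 (hiφ.add (him.const_mul κW)) fun u => ?_
          have := hpt u; dsimp only; nlinarith [this]
      _ = l2 φ φ + κW * ∫ u, ‖zmCoord 1 u‖ ^ 2 * φ u ^ 2 ∂configMeasure SU2 1 := by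
          rw [integral_add hiφ (him.const_mul κW), integral_const_mul, hl2φ]
      _ ≤ (1 + κW * (C * bareLambda B ^ 2)) * l2 φ φ := by
          have := mul_le_mul_of_nonneg_left hmom hκW
          nlinarith [this, l2_self_nonneg_lat φ]
  refine ⟨φ₀, hm.div hWm, ⟨_, hbd⟩, fun g u => ?_, fun u hu => ?_, lt_of_lt_of_le hpos hlow, ?_⟩
  · rw [hφ₀]; dsimp only; rw [hg, hWg]
  · have hφu : φ u ≠ 0 := by
      intro h; apply hu; simp [hφ₀, h]
    exact h𝒰 u (hs u hφu).1 (hs u hφu).2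
  · rw [hprod]
    -- `e^{−(C+κ_W C)λ²} μ₀ ‖φ₀‖² ≤ e^{−Cλ²} μ₀ ‖φ‖² ≤ qform φ`
    have hμ0 : 0 ≤ levelValue su2Rep 1 B 0 := (levelValue_su2Rep_pos (L := 1) hB0 0).le
    have hx : 1 + κW * (C * bareLambda B ^ 2) ≤ Real.exp (κW * C * bareLambda B ^ 2) := by
      have := Real.add_one_le_exp (κW * C * bareLambda B ^ 2); nlinarith [this]
    have h1 : Real.exp (-((C + κW * C) * bareLambda B ^ 2)) * l2 φ₀ φ₀ ≤ Real.exp (-(C * bareLambda B ^ 2)) * l2 φ φ := by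
      have e : Real.exp (-((C + κW * C) * bareLambda B ^ 2)) = Real.exp (-(C * bareLambda B ^ 2)) * Real.exp (-(κW * C * bareLambda B ^ 2)) := by
        rw [← Real.exp_add]; ring_nf
      rw [e, mul_assoc]
      refine mul_le_mul_of_nonneg_left ?_ (Real.exp_pos _).le
      have h2 : Real.exp (-(κW * C * bareLambda B ^ 2)) * Real.exp (κW * C * bareLambda B ^ 2) = 1 := by
        rw [← Real.exp_add, neg_add_cancel, Real.exp_zero]
      have h3 := mul_le_mul_of_nonneg_left (hup.trans (mul_le_mul_of_nonneg_right hx (l2_self_nonneg_lat φ))) (Real.exp_pos (-(κW * C * bareLambda B ^ 2))).le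
      calc Real.exp (-(κW * C * bareLambda B ^ 2)) * l2 φ₀ φ₀ ≤ Real.exp (-(κW * C * bareLambda B ^ 2)) * (Real.exp (κW * C * bareLambda B ^ 2) * l2 φ φ) := h3
        _ = l2 φ φ := by rw [← mul_assoc, h2, one_mul]
    calc Real.exp (-((C + κW * C) * bareLambda B ^ 2)) * levelValue su2Rep 1 B 0 * l2 φ₀ φ₀
        = levelValue su2Rep 1 B 0 * (Real.exp (-((C + κW * C) * bareLambda B ^ 2)) * l2 φ₀ φ₀) := by ring
      _ ≤ levelValue su2Rep 1 B 0 * (Real.exp (-(C * bareLambda B ^ 2)) * l2 φ φ) := mul_le_mul_of_nonneg_left h1 hμ0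
      _ = Real.exp (-(C * bareLambda B ^ 2)) * levelValue su2Rep 1 B 0 * l2 φ φ := by ring
      _ ≤ qform su2Rep B φ φ := hq

end Summit.QuantumFields.YangMills.Theorems.FemtoTransferGap.RateTube

end
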